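import Mathlib.MeasureTheory.Integral.Prod
import Mathlib.MeasureTheory.Integral.IntervalIntegral.FundThmCalculus
import Mathlib.Analysis.SpecialFunctions.ExpDeriv
import HarnessLib

/-!
# From the one-variable Stein identity to the lattice: conditional mean zero ⇒ joint mean zero

HONEST FRAMING: exact (Metropolis-corrected) sampling algorithms for lattice gauge theory;
figures of merit are autocorrelation/cost numbers at stated couplings and volumes; no
continuum-physics claim.

Venture `LatticeQCDFlow` (cell pub-lqcd), sub-topic `Exactness`; FANOUT row 9 (`eng-latcore`).  NEW
WORK of the cell (own statement and proof).  Third file of the Stein series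
(`SteinCircle.lean`: one angle on a period; `SteinRealLine.lean`: one real variable).

The Schwinger–Dyson residuals that `latflow.core.schwinger_dyson` writes per configuration are sums
over lattice variables `v` of one-variable residuals `R_v`, each an integration by parts in `v` ALONE
with every other variable frozen.  Why that suffices under the JOINT Gibbs law is Fubini: write the
configuration as `(x, θ)` = (all other variables, the chosen one); if for EVERY frozen `x` the
`θ`-integral of the residual against the joint density vanishes, the joint integral vanishes.  This
file types exactly that step, abstractly and then for an angle on a period:

* `integral_prod_eq_zero_of_forall_inner` — `f` integrable on `μ × ν` and `∫ f(x, ·) dν = 0` for every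
  `x` ⇒ `∫ f d(μ × ν) = 0`;
* **`stein_product_circle`** — `X` any σ-finite measure space (the other links / sites, any law `μ`),
  `θ ∈ (a, a + T]` with Lebesgue measure; a joint 'action' `S (x, θ)` and a test function `h (x, θ)`,
  both differentiable in `θ` for every `x`, with `θ ↦ h e^{−S}` taking equal values at `a` and
  `a + T` for every `x` (periodicity), the Stein integrand `(∂_θ h − ∂_θ S · h) e^{−S}` continuous in
  `θ` for every `x` and jointly integrable ⇒ its integral over `μ × Lebesgue|(a, a+T]` is `0`.
  With `dμ(x) e^{−S(x,θ)} dθ ∝` the joint Gibbs law this is `⟨R_v⟩ = 0` for the link `v = θ`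
  (the `e^{−S}` factor carries the whole joint weight; `μ` is the reference measure of the rest).

Not typed: the SU(N) (Haar, left-invariant vector field) version and the sum over `v`.
-/

namespace Summit.Ventures.LatticeQCDFlow.Exactness

open Real MeasureTheory Set intervalIntegral

variable {X : Type*} [MeasurableSpace X] {μ : Measure X} [SFinite μ]

/-- **Conditional mean zero ⇒ joint mean zero.**  If `f` is integrable on the product `μ × ν` and
for every `x` the inner integral `∫ y, f (x, y) ∂ν` vanishes, then `∫ f ∂(μ × ν) = 0`. -/
theorem integral_prod_eq_zero_of_forall_inner {Y : Type*} [MeasurableSpace Y] {ν : Measure Y}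
    [SFinite ν] {f : X × Y → ℝ} (hf : Integrable f (μ.prod ν))
    (hinner : ∀ x, ∫ y, f (x, y) ∂ν = 0) : ∫ z, f z ∂(μ.prod ν) = 0 := by
  rw [integral_prod f hf]
  simp [hinner]

/-- **The one-link Stein / Schwinger–Dyson identity under the joint law (angle on a period).**
`X` carries the other variables with any s-finite reference measure `μ`; the chosen link is an angle
`θ` with Lebesgue measure on `(a, a + T]` (`0 ≤ T`).  If for every `x` the maps `θ ↦ S (x, θ)` and
`θ ↦ h (x, θ)` are differentiable with derivatives `S'`, `h'`, the Stein integrand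
`(h' − S' h) e^{−S}` is continuous in `θ`, and `h e^{−S}` has equal values at `θ = a` and
`θ = a + T`; and if the Stein integrand is integrable for `μ × Lebesgue|(a, a+T]` — then its joint
integral vanishes. -/
theorem stein_product_circle {S S' h h' : X × ℝ → ℝ} {a T : ℝ} (hT : 0 ≤ T)
    (hS : ∀ x θ, HasDerivAt (fun t => S (x, t)) (S' (x, θ)) θ)
    (hh : ∀ x θ, HasDerivAt (fun t => h (x, t)) (h' (x, θ)) θ)
    (hcont : ∀ x, Continuous fun θ => (h' (x, θ) - S' (x, θ) * h (x, θ)) * Real.exp (-S (x, θ)))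
    (hper : ∀ x, h (x, a) * Real.exp (-S (x, a)) = h (x, a + T) * Real.exp (-S (x, a + T)))
    (hint : Integrable (fun z : X × ℝ => (h' z - S' z * h z) * Real.exp (-S z))
      (μ.prod (volume.restrict (Ioc a (a + T))))) :
    ∫ z, (h' z - S' z * h z) * Real.exp (-S z) ∂(μ.prod (volume.restrict (Ioc a (a + T)))) = 0 := by
  refine integral_prod_eq_zero_of_forall_inner hint (fun x => ?_)
  -- the inner integral over `Ioc a (a+T)` is the interval integral `∫_a^{a+T}`, which vanishes by FTC
  have hle : a ≤ a + T := by linarith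
  have hderiv : ∀ t ∈ uIcc a (a + T),
      HasDerivAt (fun s => h (x, s) * Real.exp (-S (x, s)))
        ((h' (x, t) - S' (x, t) * h (x, t)) * Real.exp (-S (x, t))) t := by
    intro t _
    have h1 : HasDerivAt (fun s => -S (x, s)) (-S' (x, t)) t := (hS x t).neg
    have h2 : HasDerivAt (fun s => Real.exp (-S (x, s))) (Real.exp (-S (x, t)) * (-S' (x, t))) t := h1.exp
    have h3 := (hh x t).mul h2
    have heq : (h' (x, t) - S' (x, t) * h (x, t)) * Real.exp (-S (x, t))
        = h' (x, t) * Real.exp (-S (x, t)) + h (x, t) * (Real.exp (-S (x, t)) * -S' (x, t)) := by ring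
    rw [heq]; exact h3
  have hiv : ∫ t in a..(a + T), (h' (x, t) - S' (x, t) * h (x, t)) * Real.exp (-S (x, t)) = 0 := by
    rw [integral_eq_sub_of_hasDerivAt hderiv ((hcont x).intervalIntegrable _ _), hper x, sub_self]
  rw [intervalIntegral.integral_of_le hle] at hiv
  exact hiv

end Summit.Ventures.LatticeQCDFlow.Exactness
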